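import Literature.Combinatorics.Designs.HadamardOrder

/-!
# Hadamard 668 census — the product (Kronecker / doubling) routes to order 668 are closed, in the kernel

Framing: lottery ticket; floor = certified bounds/negative ranges.

Cell pub-namedobj (venture DiscreteObjects), target (H).  The oldest constructions multiply orders: the Kronecker
(Sylvester) product of Hadamard matrices of orders `a` and `b` has order `ab`, and "doubling" is the case `a = 2`.
Since a Hadamard matrix has order `1`, `2` or `4t` (Seberry–Yamada 2020 Lemma 1.7 (iii); kernel
`HadamardOrder.card_eq_one_or_two_or_four_dvd`) and `668 = 4 · 167` with `167` prime, the only factorisations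
`668 = a · b` into two Hadamard orders are the trivial ones `{a, b} = {1, 668}`: `2 · 334` fails because `334 ≡ 2 (mod 4)`
is not a Hadamard order, `4 · 167` because `167` is odd.  This is why `668` cannot be reached from smaller Hadamard
matrices by products and must come from an array family (Williamson / Goethals–Seidel / two-circulant / T-sequences …).
* `no_hadamard_order_334`, `no_hadamard_order_167` — no Hadamard matrix of order `334` or `167`;
* `hadamard668_no_product_route` — if Hadamard matrices of orders `a` and `b` exist with `a · b = 668` then `a = 1` or
  `b = 1`.
Elementary; recorded so that the census table's 'product routes: closed' line is a kernel statement.  No `sorry`.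
-/

namespace Summit.Ventures.DiscreteObjects.Hadamard

open Literature.Combinatorics.Designs.GoethalsSeidel (IsHadamardMatrix)
open Literature.Combinatorics.Designs.HadamardOrder

/-- **no Hadamard matrix of order 334** (`334 = 2·167 ≡ 2 (mod 4)`, `> 2`). -/
theorem no_hadamard_order_334 {ι : Type*} [Fintype ι] [DecidableEq ι] {H : Matrix ι ι ℤ} (hH : IsHadamardMatrix H) :
    Fintype.card ι ≠ 334 := by
  intro h
  rcases card_eq_one_or_two_or_four_dvd hH with h1 | h2 | h4 <;> omega

/-- **no Hadamard matrix of order 167** (odd, `> 1`). -/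
theorem no_hadamard_order_167 {ι : Type*} [Fintype ι] [DecidableEq ι] {H : Matrix ι ι ℤ} (hH : IsHadamardMatrix H) :
    Fintype.card ι ≠ 167 := by
  intro h
  rcases card_eq_one_or_two_or_four_dvd hH with h1 | h2 | h4 <;> omega

/-- **the product routes to 668 are closed**: if Hadamard matrices of orders `a = |ι₁|` and `b = |ι₂|` exist with
`a · b = 668`, then `a = 1` or `b = 1` (so no Kronecker product `H(a) ⊗ H(b)`, in particular no doubling `H(2) ⊗ H(334)`,
produces order `668` from smaller Hadamard matrices). -/
theorem hadamard668_no_product_route {ι₁ ι₂ : Type*} [Fintype ι₁] [DecidableEq ι₁] [Fintype ι₂] [DecidableEq ι₂]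
    {H₁ : Matrix ι₁ ι₁ ℤ} {H₂ : Matrix ι₂ ι₂ ℤ} (h₁ : IsHadamardMatrix H₁) (h₂ : IsHadamardMatrix H₂)
    (hab : Fintype.card ι₁ * Fintype.card ι₂ = 668) : Fintype.card ι₁ = 1 ∨ Fintype.card ι₂ = 1 := by
  have d₁ := card_eq_one_or_two_or_four_dvd h₁
  have d₂ := card_eq_one_or_two_or_four_dvd h₂
  set a := Fintype.card ι₁
  set b := Fintype.card ι₂
  -- a ∣ 668 = 2² · 167, so a ∈ {1, 2, 4, 167, 334, 668}; the order lemma leaves a ∈ {1, 4, 668} (and 2 with b = 334)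
  have ha : a ∣ 668 := ⟨b, hab.symm⟩
  have ha' : a ∈ Nat.divisors 668 := Nat.mem_divisors.mpr ⟨ha, by norm_num⟩
  have hdiv : Nat.divisors 668 = {1, 2, 4, 167, 334, 668} := by decide
  rw [hdiv] at ha'
  simp only [Finset.mem_insert, Finset.mem_singleton] at ha'
  rcases ha' with e | e | e | e | e | e
  · exact Or.inl e
  · -- a = 2 ⇒ b = 334, impossible
    have hb : b = 334 := by rw [e] at hab; omega
    rcases d₂ with f | f | f <;> omega
  · -- a = 4 ⇒ b = 167, impossible
    have hb : b = 167 := by rw [e] at hab; omega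
    rcases d₂ with f | f | f <;> omega
  · -- a = 167, impossible
    rcases d₁ with f | f | f <;> omega
  · -- a = 334, impossible
    rcases d₁ with f | f | f <;> omega
  · -- a = 668 ⇒ b = 1
    right; rw [e] at hab; omega

end Summit.Ventures.DiscreteObjects.Hadamard
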